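import Summits.AtomisticToContinuum.Crystallization.Theorems.ChartedZeroExcessLayeredLatticeLiouvilleZZZG
import Summits.AtomisticToContinuum.Crystallization.Theorems.ChartedZeroExcessLayeredLatticeLiouvilleZZZE
import Summits.AtomisticToContinuum.Crystallization.Theorems.ChartedZeroExcessLayeredLatticeLiouvilleZZZL

/-!
# (GC₂-split) ZZZM — BOND-LABEL UNIQUENESS (BU₂) PROVED AT THE RECORD DIALS FROM (CC); (GC₂) ⟺ «THE bond label is coherent» (CBL₂) (lens-2 g83)

Lineage `stmt-AtomisticToContinuum-26636` (route ChartedPlanarOrder, sub Crystallization), lens-2 «structural dichotomy (special vs generic)» g83,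
critic row 1524 ORDER ① on (GC₂) `BondCoherenceP₂ … τ = 1/3000`.  The generic-side piece (GC₂) quantifies over ALL bond labels `lab` of the
`ℓ`-zone (ZC `IsBondLabel ε rΘ ℓ S K C lab`).  This file removes the quantifier:

* §1–§3 ★★★ **(BU₂) `BondLabelUniquenessP₂` — TWO BOND LABELS OF THE SAME PLACED CRYSTAL AGREE ON THE WHOLE `ℓ`-ZONE — PROVED at the record dials
  from the placed-crystal chart piece (CC) (`bondLabelUniquenessP₂_of_placedCrystalChartP`; (CC) itself is proved at the record dials by the g82
  rider ZZZK `placedCrystalChartP_record`, so (BU₂)@record is unconditional once ZZZK lands).  Mechanism, purely kinematic and combinatorial: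
  read a bond label through the global Barlow bond charts `Ψ` of `S` (tree ZJ `exists_globalChart_of_isCharted`) and `Φ` of `C` ((CC)) as an index map
  `f : ℤ³ → ℤ³`; on the zone it is injective and `BarlowAdj`-preserving (§2 `labelRead_props`); two labels agree at every COOL zone atom (collar clause
  (iv): both labels within `ε = 10⁻⁴` of the atom, `C` is `17/20`-separated — `labelRead_eq_of_cool`); from a WARM atom (`d(p, K) ≤ rΘ`) an OUTWARD
  CONE WALK (§1 `exists_path_outward`: tree ZZX `exists_barlowAdj_toward` + `exists_path_to_goal`, the potential `dist(Ψ ·, x₀)` strictly increasing,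
  finiteness by tree ZZZG `finite_chartSites_near_univ`) reaches a site whose CLOSED STAR IS FULLY COOL while every site met keeps its closed star in
  the zone (dial inequality `rΘ + 2q + 3·(28/25) < ℓ`: `20.4225 < 21.5`); then the rider ZZZL (`AgreeStar.of_path_in_region`: Barlow STAR RIGIDITY by
  `decide` + counting) continues the agreement back to `p`.
* §4 **(CBL₂) `CoherentBondLabelP₂`** — «SOME bond label is `(ϑp + τ, 2ϑp + τ)`-coherent on the tame core stars» (= (GL₂) ∧ (GC₂) packaged,
  `coherentBondLabelP₂_of_bondLabel₂`), and the junctions: (BU₂) ∧ (CBL₂) ⟹ (GC₂) (`bondCoherenceP₂_of_unique₂`, needs `rm + 4 < ℓ`);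
  (CBL₂) ⟹ (SV₂) (`singleVariantP₂_of_coherentBondLabel₂`); the docket slot with (CBL₂) in place of (GL₂) ∧ (GC₂)
  (`coolMoatSlavedFillingP_tubeSlot_of_coherentBondLabel₂`, same leaf as ZZZE); at the record dials (GC₂) ⟸ (CC) ∧ (CBL₂)
  (`bondCoherenceP₂_record_of_coherent`).

CONSEQUENCE FOR THE TREE (the lens's dichotomy, generic side): with (GL₂)@record PROVED (g82) and (BU₂)@record PROVED (here), the bond label of the
record docket is ONE CANONICAL OBJECT — the Θ-registration label of ZZP/ZZZC — and (GC₂)@record is EQUIVALENT to the coherence of THAT label: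
(GC₂) cannot be won by choosing the label cleverly, and the ∀-label consumer pieces (AR₂)/(LN₂)/(CV₂) are statements about the canonical label.  What
(GC₂) then asserts is priced in the cell memo `g83/memo/FINDING-OM.md` («orientation locking»): it is NOT chart accuracy but the absence of
index-twisted (point-group-rotated) strain states inside the warm core — kinematically a knife-edge at the record dials, equilibrium-type in substance.

TAGS: (BU₂) KINEMATIC · PROVED@record from (CC) (this file) · (CBL₂) UNDECIDED · EQUILIBRIUM-TYPE (orientation locking; memo FINDING-OM) — it REPLACES
(GL₂) ∧ (GC₂) in the slot and is what the docket consumes ((SV₂) with bond structure).  Why (BU₂) might have failed: a non-trivial automorphism of a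
link graph fixing a closed vertex star (excluded by ZZZL `fillsB_all`), or a warm region not chained to a cool star inside the zone (excluded by the
outward cone walk).  Sources: tree ZH/ZJ/ZU/ZV/ZZ/ZZX/ZZZG, rider ZZZL; Conway–Sloane SPLAG ch. 4 (cuboctahedron / anticuboctahedron links of fcc/hcp).

0 sorry; imports = tree ZZZG, ZZZE + rider ZZZL (lands first); axioms standard.
-/

noncomputable section

open scoped BigOperators Classical InnerProductSpace RealInnerProductSpace
open MeasureTheory Set Metric Filter Topology
open Literature.Geometry.DiscreteGeometry (IsTwoShellGoodSet)
open Literature.MathematicalPhysics.StatisticalMechanics (lennardJones)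

namespace Summit.AtomisticToContinuum.Crystallization.Theorems.ChartedZeroExcessLayeredLatticeLiouville

open Summit.AtomisticToContinuum.Crystallization.Theorems.ChartedPlanarOrderRigidityDoor (E3 IsClean)
open Summit.AtomisticToContinuum.Crystallization.Theorems.ChartedPlanarOrderDensityDichotomy (μS IsSep)
open Summit.AtomisticToContinuum.Crystallization.Theorems.ChartedPlanarOrderCleanScaleP (IsCleanP IsDoorSetP)
open Summit.AtomisticToContinuum.Crystallization.Theorems.ChartedPlanarOrderMesoCut (LayeredHom EnvClose)
open Summit.AtomisticToContinuum.Crystallization.Theorems.ChartedPlanarOrderDoorLayeredOsc (IsTwoShellAffineGood)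

/-! ### ZZZM-1  Outward cone walks in a charted clean set -/

/-- paths transfer along an implication of relations. [formal bookkeeping] -/
theorem reflTransGen_mono' {α : Type*} {r p : α → α → Prop} (h : ∀ a b, r a b → p a b) {x y : α}
    (hxy : Relation.ReflTransGen r x y) : Relation.ReflTransGen p x y := by
  induction hxy with
  | refl => exact Relation.ReflTransGen.refl
  | tail _ hbc ih => exact ih.tail (h _ _ hbc)

/-- ★ A STEP AWAY FROM ANY POINT: every site has a Barlow neighbour strictly farther from `x₀`, one bond (`≤ 28/25`) away (tree ZZX
`exists_barlowAdj_toward`: a clean atom has a neighbour within `60°` of any direction). [this file, g83] -/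
theorem exists_barlowAdj_farther {S : Set E3} {Ψ : ℤ × ℤ × ℤ → E3} {τ : ℤ → Bool}
    (hΨ : IsBarlowBondChart S Set.univ Ψ τ) (hsurjΨ : ∀ p ∈ S, ∃ x, Ψ x = p)
    (hclean : ∀ p ∈ S, IsTwoShellGoodSet (1 / 16) (9 / 10) 1 S p) (a : ℤ × ℤ × ℤ) (x₀ : E3) :
    ∃ a' : ℤ × ℤ × ℤ, BarlowAdj τ a a' ∧ dist (Ψ a) x₀ < dist (Ψ a') x₀ ∧ dist (Ψ a') (Ψ a) ≤ 28 / 25 := by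
  by_cases h : Ψ a = x₀
  · have hb : IsBond (Ψ a) (Ψ (linkPt τ a 0)) :=
      (hΨ.2.2 a (mem_univ _) _ (mem_univ _)).2 (barlowAdj_linkPt τ a 0)
    refine ⟨linkPt τ a 0, barlowAdj_linkPt τ a 0, ?_, by rw [dist_comm]; exact hb.2⟩
    rw [h, dist_self, ← h, dist_comm]
    exact hb.1
  · have hw : Ψ a - x₀ ≠ 0 := sub_ne_zero.2 h
    obtain ⟨a', hadj, hpos, hle, hcone⟩ := exists_barlowAdj_toward hΨ hsurjΨ hclean a hw
    refine ⟨a', hadj, ?_, by linarith⟩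
    rw [dist_eq_norm] at hpos
    rw [dist_eq_norm, dist_eq_norm]
    have hsq : ‖Ψ a' - x₀‖ ^ 2 = ‖Ψ a' - Ψ a‖ ^ 2 + 2 * ⟪Ψ a' - Ψ a, Ψ a - x₀⟫ + ‖Ψ a - x₀‖ ^ 2 := by
      rw [← norm_add_sq_real]; congr 1; abel
    have hlt : ‖Ψ a - x₀‖ ^ 2 < ‖Ψ a' - x₀‖ ^ 2 := by
      rw [hsq]
      nlinarith [mul_pos hpos hpos, mul_nonneg (norm_nonneg (Ψ a' - Ψ a)) (norm_nonneg (Ψ a - x₀)), hcone]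
    exact lt_of_pow_lt_pow_left₀ 2 (norm_nonneg _) hlt

/-- ★ THE OUTWARD WALK: from a site within `G + 28/25` of `x₀`, a Barlow path through sites within `G + 28/25` of `x₀` to a site at distance in
`(G, G + 28/25]` (finite descent on `−dist(Ψ ·, x₀)`, tree ZZX `exists_path_to_goal`; finiteness by ZZZG). [this file, g83] -/
theorem exists_path_outward {S : Set E3} {Ψ : ℤ × ℤ × ℤ → E3} {τ : ℤ → Bool} {x₀ : E3} {δ G : ℝ}
    (hΨ : IsBarlowBondChart S Set.univ Ψ τ) (hsurjΨ : ∀ p ∈ S, ∃ x, Ψ x = p)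
    (hclean : ∀ p ∈ S, IsTwoShellGoodSet (1 / 16) (9 / 10) 1 S p) (hδ : 0 < δ) (hsep : IsSep δ S)
    {x : ℤ × ℤ × ℤ} (hx : dist (Ψ x) x₀ ≤ G + 28 / 25) :
    ∃ z : ℤ × ℤ × ℤ, G < dist (Ψ z) x₀ ∧ dist (Ψ z) x₀ ≤ G + 28 / 25 ∧
      Relation.ReflTransGen
        (fun a b => dist (Ψ a) x₀ ≤ G + 28 / 25 ∧ dist (Ψ b) x₀ ≤ G + 28 / 25 ∧ BarlowAdj τ a b) x z := by
  classical
  have hfin : Set.Finite {y : ℤ × ℤ × ℤ | ∃ k ∈ ({x₀} : Set E3), dist (Ψ y) k ≤ G + 28 / 25} :=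
    finite_chartSites_near_univ (K := ({x₀} : Set E3)) (q := 0) hδ hsep hΨ
      (fun k hk => by rw [mem_singleton_iff.1 hk, dist_self])
  have key := exists_path_to_goal
    (fun a b => dist (Ψ a) x₀ ≤ G + 28 / 25 ∧ dist (Ψ b) x₀ ≤ G + 28 / 25 ∧ BarlowAdj τ a b)
    {a | dist (Ψ a) x₀ ≤ G + 28 / 25} (fun a => G < dist (Ψ a) x₀) (fun a => -dist (Ψ a) x₀) hfin.toFinset
    (fun a ha => hfin.mem_toFinset.2 ⟨x₀, mem_singleton x₀, ha⟩) ?_ x hx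
  · obtain ⟨z, hz, hgz, hpath⟩ := key
    exact ⟨z, hgz, hz, hpath⟩
  intro a ha hga
  push Not at hga
  obtain ⟨a', hadj, hlt, hlen⟩ := exists_barlowAdj_farther hΨ hsurjΨ hclean a x₀
  have ha' : dist (Ψ a') x₀ ≤ G + 28 / 25 := by linarith [dist_triangle (Ψ a') (Ψ a) x₀]
  exact ⟨a', ha', ⟨ha, ha', hadj⟩, by linarith⟩

/-! ### ZZZM-2  A bond label read through the charts -/

/-- ★ a bond label HAS an index reading `f` through the charts: `Φ (f x) = lab (Ψ x)` on the zone. [this file, g83] -/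
theorem exists_labelRead {S K C : Set E3} {Ψ Φ : ℤ × ℤ × ℤ → E3} {τS : ℤ → Bool} {ε rΘ ℓ : ℝ} {lab : E3 → E3}
    (hΨ : IsBarlowBondChart S Set.univ Ψ τS) (hsurjΦ : ∀ c ∈ C, ∃ y, Φ y = c) (hlab : IsBondLabel ε rΘ ℓ S K C lab) :
    ∃ f : ℤ × ℤ × ℤ → ℤ × ℤ × ℤ, ∀ x, (∃ k ∈ K, dist (Ψ x) k < ℓ) → Φ (f x) = lab (Ψ x) := by
  classical
  refine ⟨fun x => if h : lab (Ψ x) ∈ C then (hsurjΦ _ h).choose else 0, fun x hx => ?_⟩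
  have hC : lab (Ψ x) ∈ C := hlab.1 _ (hΨ.2.1 (mem_univ x)) hx
  simp only [dif_pos hC]
  exact (hsurjΦ _ hC).choose_spec

/-- ★ an index reading of a bond label is INJECTIVE and `BarlowAdj`-PRESERVING on the zone (label clauses (ii), (iii); charts' bond dictionaries).
[this file, g83] -/
theorem labelRead_props {S K C : Set E3} {Ψ Φ : ℤ × ℤ × ℤ → E3} {τS τC : ℤ → Bool} {ε rΘ ℓ : ℝ} {lab : E3 → E3}
    (hΨ : IsBarlowBondChart S Set.univ Ψ τS) (hΦ : IsBarlowBondChart C Set.univ Φ τC)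
    (hlab : IsBondLabel ε rΘ ℓ S K C lab) {f : ℤ × ℤ × ℤ → ℤ × ℤ × ℤ}
    (hf : ∀ x, (∃ k ∈ K, dist (Ψ x) k < ℓ) → Φ (f x) = lab (Ψ x)) :
    Set.InjOn f {x | ∃ k ∈ K, dist (Ψ x) k < ℓ} ∧
      ∀ a ∈ {x : ℤ × ℤ × ℤ | ∃ k ∈ K, dist (Ψ x) k < ℓ}, ∀ b ∈ {x : ℤ × ℤ × ℤ | ∃ k ∈ K, dist (Ψ x) k < ℓ},
        BarlowAdj τS a b → BarlowAdj τC (f a) (f b) := by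
  have hS : ∀ x, Ψ x ∈ S := fun x => hΨ.2.1 (mem_univ x)
  refine ⟨fun a ha b hb hab => ?_, fun a ha b hb hadj => ?_⟩
  · have h1 : lab (Ψ a) = lab (Ψ b) := by rw [← hf a ha, ← hf b hb, hab]
    have h2 : Ψ a = Ψ b := hlab.2.2.1 ⟨hS a, ha⟩ ⟨hS b, hb⟩ h1
    exact hΨ.1 (mem_univ a) (mem_univ b) h2
  · have hb' : IsBond (Ψ a) (Ψ b) := (hΨ.2.2 a (mem_univ a) b (mem_univ b)).2 hadj
    have hlb : IsBond (lab (Ψ a)) (lab (Ψ b)) := hlab.2.1 _ (hS a) _ (hS b) ha hb hb'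
    rw [← hf a ha, ← hf b hb] at hlb
    exact (hΦ.2.2 _ (mem_univ _) _ (mem_univ _)).1 hlb

/-- ★ TWO READINGS AGREE AT A COOL ZONE SITE: both labels are within `ε` of the atom (collar clause (iv)) and `C` is `σC > 2ε` separated.
[this file, g83] -/
theorem labelRead_eq_of_cool {S K C : Set E3} {Ψ Φ : ℤ × ℤ × ℤ → E3} {τS τC : ℤ → Bool} {σC ε rΘ ℓ : ℝ}
    {lab lab' : E3 → E3} (hΨ : IsBarlowBondChart S Set.univ Ψ τS) (hΦ : IsBarlowBondChart C Set.univ Φ τC)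
    (hsepC : IsSep σC C) (hε : 2 * ε < σC) (hlab : IsBondLabel ε rΘ ℓ S K C lab) (hlab' : IsBondLabel ε rΘ ℓ S K C lab')
    {f f' : ℤ × ℤ × ℤ → ℤ × ℤ × ℤ} (hf : ∀ x, (∃ k ∈ K, dist (Ψ x) k < ℓ) → Φ (f x) = lab (Ψ x))
    (hf' : ∀ x, (∃ k ∈ K, dist (Ψ x) k < ℓ) → Φ (f' x) = lab' (Ψ x)) {w : ℤ × ℤ × ℤ}
    (hz : ∃ k ∈ K, dist (Ψ w) k < ℓ) (hcool : ∀ k ∈ K, rΘ < dist (Ψ w) k) : f w = f' w := by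
  have hS : Ψ w ∈ S := hΨ.2.1 (mem_univ w)
  have h1 : dist (Ψ w) (lab (Ψ w)) ≤ ε := hlab.2.2.2 _ hS hz hcool
  have h2 : dist (Ψ w) (lab' (Ψ w)) ≤ ε := hlab'.2.2.2 _ hS hz hcool
  have hC1 : lab (Ψ w) ∈ C := hlab.1 _ hS hz
  have hC2 : lab' (Ψ w) ∈ C := hlab'.1 _ hS hz
  have heq : lab (Ψ w) = lab' (Ψ w) := by
    by_contra hne
    have := hsepC _ hC1 _ hC2 hne
    linarith [dist_triangle_left (lab (Ψ w)) (lab' (Ψ w)) (Ψ w)]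
  apply hΦ.1 (mem_univ _) (mem_univ _)
  rw [hf w hz, hf' w hz, heq]

/-! ### ZZZM-3  ★★★ Bond-label uniqueness on the zone -/

/-- ★★★ **BOND-LABEL UNIQUENESS (pointwise form).**  Two bond labels of a globally charted clean separated `S` into a globally charted separated `C`
(collar radius `rΘ`, zone `ℓ`, container `K ⊆ B̄(x₀, q)`, `rΘ + 2q + 3·(28/25) < ℓ`, `2ε < σC`) AGREE ON THE WHOLE `ℓ`-ZONE. [this file, g83] -/
theorem bondLabel_unique {S K C : Set E3} {Ψ Φ : ℤ × ℤ × ℤ → E3} {τS τC : ℤ → Bool} {x₀ : E3}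
    {δ σC ε rΘ ℓ q : ℝ} {lab lab' : E3 → E3}
    (hΨ : IsBarlowBondChart S Set.univ Ψ τS) (hsurjΨ : ∀ p ∈ S, ∃ x, Ψ x = p)
    (hclean : ∀ p ∈ S, IsTwoShellGoodSet (1 / 16) (9 / 10) 1 S p) (hδ : 0 < δ) (hsepS : IsSep δ S)
    (hΦ : IsBarlowBondChart C Set.univ Φ τC) (hsurjΦ : ∀ c ∈ C, ∃ y, Φ y = c) (hsepC : IsSep σC C) (hε : 2 * ε < σC)
    (hKq : ∀ k ∈ K, dist k x₀ ≤ q) (hdial : rΘ + 2 * q + 3 * (28 / 25) < ℓ)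
    (hlab : IsBondLabel ε rΘ ℓ S K C lab) (hlab' : IsBondLabel ε rΘ ℓ S K C lab') :
    ∀ p ∈ S, (∃ k ∈ K, dist p k < ℓ) → lab p = lab' p := by
  intro p hp hpz
  have hKne := hpz
  obtain ⟨k₀, hk₀, -⟩ := hKne
  obtain ⟨f, hf⟩ := exists_labelRead hΨ hsurjΦ hlab
  obtain ⟨f', hf'⟩ := exists_labelRead hΨ hsurjΦ hlab'
  obtain ⟨x, rfl⟩ := hsurjΨ p hp
  -- cool atoms: directly
  by_cases hcool : ∀ k ∈ K, rΘ < dist (Ψ x) k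
  · rw [← hf x hpz, ← hf' x hpz, labelRead_eq_of_cool hΨ hΦ hsepC hε hlab hlab' hf hf' hpz hcool]
  -- warm atoms: walk out to a fully cool closed star, continue the agreement back (rider ZZZL)
  push Not at hcool
  obtain ⟨k₁, hk₁, hpk₁⟩ := hcool
  set G : ℝ := rΘ + q + 28 / 25 with hG
  have hxG : dist (Ψ x) x₀ ≤ G + 28 / 25 := by
    rw [hG]; linarith [dist_triangle (Ψ x) k₁ x₀, hKq k₁ hk₁]
  obtain ⟨z, hzG, hzV, hpath⟩ := exists_path_outward (G := G) hΨ hsurjΨ hclean hδ hsepS hxG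
  have hzone : ∀ a : ℤ × ℤ × ℤ, dist (Ψ a) x₀ ≤ G + 2 * (28 / 25) → ∃ k ∈ K, dist (Ψ a) k < ℓ := fun a ha =>
    ⟨k₀, hk₀, by rw [hG] at ha; linarith [dist_triangle (Ψ a) x₀ k₀, hKq k₀ hk₀, dist_comm x₀ k₀]⟩
  have hlink : ∀ a : ℤ × ℤ × ℤ, ∀ i, dist (Ψ a) (Ψ (linkPt τS a i)) ≤ 28 / 25 := fun a i =>
    ((hΨ.2.2 a (mem_univ _) _ (mem_univ _)).2 (barlowAdj_linkPt τS a i)).2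
  have hV_R : ∀ b : ℤ × ℤ × ℤ, dist (Ψ b) x₀ ≤ G + 28 / 25 →
      (∃ k ∈ K, dist (Ψ b) k < ℓ) ∧ ∀ i, ∃ k ∈ K, dist (Ψ (linkPt τS b i)) k < ℓ := fun b hb =>
    ⟨hzone b (by linarith), fun i =>
      hzone _ (by linarith [dist_triangle (Ψ (linkPt τS b i)) (Ψ b) x₀, hlink b i, dist_comm (Ψ b) (Ψ (linkPt τS b i))])⟩
  obtain ⟨hinj, hhom⟩ := labelRead_props hΨ hΦ hlab hf
  obtain ⟨hinj', hhom'⟩ := labelRead_props hΨ hΦ hlab' hf'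
  -- the closed star of `z` is fully cool
  have hcoolPt : ∀ w : ℤ × ℤ × ℤ, G - 28 / 25 < dist (Ψ w) x₀ → ∀ k ∈ K, rΘ < dist (Ψ w) k := fun w hw k hk => by
    rw [hG] at hw; linarith [dist_triangle (Ψ w) k x₀, hKq k hk]
  have hAz : AgreeStar τS f f' z := by
    refine ⟨labelRead_eq_of_cool hΨ hΦ hsepC hε hlab hlab' hf hf' (hV_R z hzV).1 (hcoolPt z (by linarith)), fun i => ?_⟩
    exact labelRead_eq_of_cool hΨ hΦ hsepC hε hlab hlab' hf hf' ((hV_R z hzV).2 i)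
      (hcoolPt _ (by linarith [dist_triangle (Ψ z) (Ψ (linkPt τS z i)) x₀, hlink z i]))
  -- continue back along the reversed walk
  have hrev := reflTransGen_reverse
    (R := fun a b => dist (Ψ a) x₀ ≤ G + 28 / 25 ∧ dist (Ψ b) x₀ ≤ G + 28 / 25 ∧ BarlowAdj τS a b)
    (fun a b h => ⟨h.2.1, h.1, barlowAdj_symm h.2.2⟩) hpath
  have hpath' : Relation.ReflTransGen
      (fun a b => BarlowAdj τS a b ∧ b ∈ {x : ℤ × ℤ × ℤ | ∃ k ∈ K, dist (Ψ x) k < ℓ} ∧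
        ∀ i, linkPt τS b i ∈ {x : ℤ × ℤ × ℤ | ∃ k ∈ K, dist (Ψ x) k < ℓ}) z x :=
    reflTransGen_mono' (fun a b h => ⟨h.2.2, (hV_R b h.2.1).1, (hV_R b h.2.1).2⟩) hrev
  have hAx : AgreeStar τS f f' x := hAz.of_path_in_region hinj hhom hinj' hhom' hpath'
  rw [← hf x hpz, ← hf' x hpz, hAx.1]

/-! ### ZZZM-4  The pieces (BU₂), (CBL₂) and their junctions -/

section W1PiecesBis

/-- ★★★ **(BU₂) `BondLabelUniquenessP₂` — BOND-LABEL UNIQUENESS ON THE ZONE** (binder telescope of ZZZD `BondLabelP₂` verbatim): any two bond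
labels read from `rΘ` agree at every atom of the `ℓ`-zone of `K`.  KINEMATIC; PROVED at the record dials from (CC) below. [this file, g83] -/
def BondLabelUniquenessP₂ (ϑc ϑp r rΘ q rsh rm σ ϑr Rs ε rI ℓ aHi Λ θ s : ℝ) : Prop :=
  ∀ δ : ℝ, 0 < δ → ∀ a : ℝ, 0 < a →
    ∀ S : Set E3, IsDoorSetP aHi δ S → (∀ z : E3, Summable fun y : S => lennardJones (dist z (y : E3))) →
      (∀ p ∈ S, IsTwoShellAffineGood θ S p) →
        ∀ (L : E3 ≃L[ℝ] E3) (w : ℤ → E3), IsEquilChart a s Λ L w →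
          ∀ (x₀ : E3) (K : Set E3), K ⊆ S → (∀ k ∈ K, dist k x₀ ≤ q) →
            IsTameOn ϑp S (LayeredHom (L : E3 →L[ℝ] E3) w) (coreOf S K rm) →
              IsTameOn ϑc S (LayeredHom (L : E3 →L[ℝ] E3) w) (moatIn S K r (r + rsh)) →
                ∀ (L' : E3 →L[ℝ] E3) (w' : ℤ → E3) (U : E3 ≃ₗᵢ[ℝ] E3) (t : E3),
                  IsCoolShadowCrystal σ ϑr Rs ε r rI ℓ S K (LayeredHom (L : E3 →L[ℝ] E3) w) L' w' U t →
                    ∀ lab lab' : E3 → E3, IsBondLabel ε rΘ ℓ S K (placedCrystal L' w' U t) lab →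
                      IsBondLabel ε rΘ ℓ S K (placedCrystal L' w' U t) lab' →
                        ∀ p ∈ S, (∃ k ∈ K, dist p k < ℓ) → lab p = lab' p

/-- ★★★ **(BU₂) AT THE RECORD DIALS FROM (CC) AT `(17/20, 10⁻⁴, 5)`, for every `ϑc`** (`145/16 + 8 + 84/25 < 43/2`, `2·10⁻⁴ < 17/20`).
[this file, g83] -/
theorem bondLabelUniquenessP₂_of_placedCrystalChartP (hCC : PlacedCrystalChartP (17 / 20) (1 / 10000) 5) (ϑc : ℝ) :
    BondLabelUniquenessP₂ ϑc (1 / 10) 8 (145 / 16) 4 12 16 (17 / 20) (1 / 10000) 5 (1 / 10000) 10 (43 / 2) 1 2 (1 / 16) (1 / 50) := by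
  intro δ hδ a ha S hS hsum hgood L w hL x₀ K hKS hKq hTp hTc L' w' U t hcr lab lab' hlab hlab'
  obtain ⟨Φ, τC, hΦ, hsurjΦ⟩ := hCC _ hL.2.2.2.1 L' w' U t hcr.2.1 hcr.2.2.1
  obtain ⟨Ψ, τS, hΨ, hsurjΨ⟩ := exists_globalChart_of_isCharted hS.2.2.2.2
  have hclean : ∀ p ∈ S, IsTwoShellGoodSet (1 / 16) (9 / 10) 1 S p := fun p hp => isTwoShellGoodSet_of_isDoorSetP hS hp
  have hsepS : IsSep (27 / 32) S := isSep_of_isDoorSetP le_rfl hS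
  have hsepC : IsSep (17 / 20) (placedCrystal L' w' U t) := isSep_placedCrystal U t hcr.2.1
  exact bondLabel_unique hΨ hsurjΨ hclean (by norm_num) hsepS hΦ hsurjΦ hsepC (by norm_num) hKq (by norm_num) hlab hlab'

/-- ★★ **(CBL₂) `CoherentBondLabelP₂` — SOME BOND LABEL IS COHERENT ON THE TAME CORE STARS** ((GL₂)'s `∃ lab` carrying (GC₂)'s two coherence
clauses; binder telescope of ZZZD `BondCoherenceP₂` verbatim).  Under (BU₂) this is EQUIVALENT to (GL₂) ∧ (GC₂); it is what the docket consumes.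
UNDECIDED · EQUILIBRIUM-TYPE («orientation locking», memo FINDING-OM). [this file, g83] -/
def CoherentBondLabelP₂ (ϑc ϑp r rΘ q rsh rm σ ϑr Rs ε rI ℓ τ aHi Λ θ s : ℝ) : Prop :=
  ∀ δ : ℝ, 0 < δ → ∀ a : ℝ, 0 < a →
    ∀ S : Set E3, IsDoorSetP aHi δ S → (∀ z : E3, Summable fun y : S => lennardJones (dist z (y : E3))) →
      (∀ p ∈ S, IsTwoShellAffineGood θ S p) →
        ∀ (L : E3 ≃L[ℝ] E3) (w : ℤ → E3), IsEquilChart a s Λ L w →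
          ∀ (x₀ : E3) (K : Set E3), K ⊆ S → (∀ k ∈ K, dist k x₀ ≤ q) →
            IsTameOn ϑp S (LayeredHom (L : E3 →L[ℝ] E3) w) (coreOf S K rm) →
              IsTameOn ϑc S (LayeredHom (L : E3 →L[ℝ] E3) w) (moatIn S K r (r + rsh)) →
                ∀ (L' : E3 →L[ℝ] E3) (w' : ℤ → E3) (U : E3 ≃ₗᵢ[ℝ] E3) (t : E3),
                  IsCoolShadowCrystal σ ϑr Rs ε r rI ℓ S K (LayeredHom (L : E3 →L[ℝ] E3) w) L' w' U t →
                    ∃ lab : E3 → E3, IsBondLabel ε rΘ ℓ S K (placedCrystal L' w' U t) lab ∧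
                      (∀ x ∈ coreOf S K rm, ∀ p ∈ S, dist p x ≤ 4 → |dist x p - dist (lab x) (lab p)| ≤ ϑp + τ) ∧
                        ∀ y ∈ coreOf S K rm, ∀ x ∈ S, ∀ p ∈ S, dist x y ≤ 4 → dist p y ≤ 4 →
                          |dist x p - dist (lab x) (lab p)| ≤ 2 * ϑp + τ

/-- (GL₂) ∧ (GC₂) ⟹ (CBL₂). [formal bookkeeping] -/
theorem coherentBondLabelP₂_of_bondLabel₂ {ϑc ϑp r rΘ q rsh rm σ ϑr Rs ε rI ℓ τ aHi Λ θ s : ℝ}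
    (hGL : BondLabelP₂ ϑc ϑp r rΘ q rsh rm σ ϑr Rs ε rI ℓ aHi Λ θ s)
    (hGC : BondCoherenceP₂ ϑc ϑp r rΘ q rsh rm σ ϑr Rs ε rI ℓ τ aHi Λ θ s) :
    CoherentBondLabelP₂ ϑc ϑp r rΘ q rsh rm σ ϑr Rs ε rI ℓ τ aHi Λ θ s := by
  intro δ hδ a ha S hS hsum hgood L w hL x₀ K hKS hKq hTp hTc L' w' U t hC
  obtain ⟨lab, hlab⟩ := hGL δ hδ a ha S hS hsum hgood L w hL x₀ K hKS hKq hTp hTc L' w' U t hC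
  obtain ⟨h₂, h₃⟩ := hGC δ hδ a ha S hS hsum hgood L w hL x₀ K hKS hKq hTp hTc L' w' U t hC lab hlab
  exact ⟨lab, hlab, h₂, h₃⟩

/-- ★★ (BU₂) ∧ (CBL₂) ⟹ (GC₂) (`rm + 4 < ℓ`): every bond label equals the coherent one on the core stars. [this file, g83] -/
theorem bondCoherenceP₂_of_unique₂ {ϑc ϑp r rΘ q rsh rm σ ϑr Rs ε rI ℓ τ aHi Λ θ s : ℝ} (hrm : rm + 4 < ℓ)
    (hBU : BondLabelUniquenessP₂ ϑc ϑp r rΘ q rsh rm σ ϑr Rs ε rI ℓ aHi Λ θ s)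
    (hCBL : CoherentBondLabelP₂ ϑc ϑp r rΘ q rsh rm σ ϑr Rs ε rI ℓ τ aHi Λ θ s) :
    BondCoherenceP₂ ϑc ϑp r rΘ q rsh rm σ ϑr Rs ε rI ℓ τ aHi Λ θ s := by
  intro δ hδ a ha S hS hsum hgood L w hL x₀ K hKS hKq hTp hTc L' w' U t hC lab hlab
  obtain ⟨lab₀, hlab₀, h₂, h₃⟩ := hCBL δ hδ a ha S hS hsum hgood L w hL x₀ K hKS hKq hTp hTc L' w' U t hC
  have heq := hBU δ hδ a ha S hS hsum hgood L w hL x₀ K hKS hKq hTp hTc L' w' U t hC lab lab₀ hlab hlab₀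
  have hz : ∀ y ∈ coreOf S K rm, ∀ p ∈ S, dist p y ≤ 4 → lab p = lab₀ p := fun y hy p hp hpy => by
    obtain ⟨-, k, hk, hyk⟩ := hy
    exact heq p hp ⟨k, hk, by linarith [dist_triangle p y k]⟩
  refine ⟨fun x hx p hp hpx => ?_, fun y hy x hx p hp hxy hpy => ?_⟩
  · rw [hz x hx x hx.1 (by rw [dist_self]; norm_num), hz x hx p hp hpx]
    exact h₂ x hx p hp hpx
  · rw [hz y hy x hx hxy, hz y hy p hp hpy]
    exact h₃ y hy x hx p hp hxy hpy

/-- ★★ (CBL₂) ⟹ (SV₂): a coherent bond label is a variant label (clauses (i), (iv) from the bond label). [this file, g83] -/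
theorem singleVariantP₂_of_coherentBondLabel₂ {ϑc ϑp r rΘ q rsh rm σ ϑr Rs ε rI ℓ τ aHi Λ θ s : ℝ}
    (hCBL : CoherentBondLabelP₂ ϑc ϑp r rΘ q rsh rm σ ϑr Rs ε rI ℓ τ aHi Λ θ s) :
    SingleVariantP₂ ϑc ϑp r rΘ q rsh rm σ ϑr Rs ε rI ℓ τ aHi Λ θ s := by
  intro δ hδ a ha S hS hsum hgood L w hL x₀ K hKS hKq hTp hTc L' w' U t hC
  obtain ⟨lab, hlab, h₂, h₃⟩ := hCBL δ hδ a ha S hS hsum hgood L w hL x₀ K hKS hKq hTp hTc L' w' U t hC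
  exact ⟨lab, hlab.1, h₂, h₃, hlab.2.2.2⟩

/-- ★★ (GC₂) AT THE RECORD DIALS ⟸ (CC) ∧ (CBL₂) (`16 + 4 < 43/2`). [this file, g83] -/
theorem bondCoherenceP₂_record_of_coherent (hCC : PlacedCrystalChartP (17 / 20) (1 / 10000) 5) (ϑc : ℝ)
    (hCBL : CoherentBondLabelP₂ ϑc (1 / 10) 8 (145 / 16) 4 12 16 (17 / 20) (1 / 10000) 5 (1 / 10000) 10 (43 / 2) (1 / 3000) 1 2
      (1 / 16) (1 / 50)) :
    BondCoherenceP₂ ϑc (1 / 10) 8 (145 / 16) 4 12 16 (17 / 20) (1 / 10000) 5 (1 / 10000) 10 (43 / 2) (1 / 3000) 1 2 (1 / 16) (1 / 50) :=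
  bondCoherenceP₂_of_unique₂ (by norm_num) (bondLabelUniquenessP₂_of_placedCrystalChartP hCC ϑc) hCBL

/-- THE DOCKET SLOT with (CBL₂) in place of (GL₂) ∧ (GC₂): (SC) ∧ (CBL₂) ∧ (AR₂) ∧ (LN₂) ∧ (CV₂) ∧ (X1) ∧ (X2ᴸ♮) ⟹ the SAME leaf as ZZZE
`coolMoatSlavedFillingP_tubeSlot_of_bondLabel₂`. [this file, g83] -/
theorem coolMoatSlavedFillingP_tubeSlot_of_coherentBondLabel₂ {ϑc lam : ℝ} (hlam : 0 < lam)
    (hSC : CoolZoneShadowCrystalP ϑc (1 / 10) 8 4 12 16 (17 / 20) (1 / 10000) 5 (1 / 10000) 10 (43 / 2) 1 2 (1 / 16) (1 / 50))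
    (hCBL : CoherentBondLabelP₂ ϑc (1 / 10) 8 (145 / 16) 4 12 16 (17 / 20) (1 / 10000) 5 (1 / 10000) 10 (43 / 2) (1 / 3000) 1 2
      (1 / 16) (1 / 50))
    (hAR : AnchorRegistrationP₂ ϑc (1 / 10) 8 (145 / 16) 4 12 16 (17 / 20) (1 / 10000) 5 (1 / 10000) 10 (43 / 2) (1 / 3000) (1 / 1000) 1 2
      (1 / 16) (1 / 50))
    (hLN : LabelledNetP₂ ϑc (1 / 10) 8 (145 / 16) 4 12 16 (17 / 20) (1 / 10000) 5 (1 / 10000) 10 (43 / 2) (1 / 3000) (1 / 100) (4 / 5) (1 / 2)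
      2 1 2 (1 / 16) (1 / 50))
    (hCV : LabelCoveringP₂ ϑc (1 / 10) 8 (145 / 16) 4 12 16 (17 / 20) (1 / 10000) 5 (1 / 10000) 10 (43 / 2) (1 / 3000) 1 2 (1 / 16) (1 / 50))
    (hX1 : TubeConvexityP ϑc (1 / 100) (1 / 10) 8 4 12 16 16 (1 / 2) (1 / 5000) 5 (3 / 400) (3 / 400) (1 / 10) lam 1 2 (1 / 16) (1 / 50))
    (hX2 : ShadowLoadedTubeAprioriP ϑc (1 / 100) (1 / 10) 8 4 12 16 16 (1 / 2) (1 / 5000) 5 (3 / 400) (3 / 400) (1 / 10) (17 / 20) (1 / 10000)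
      (1 / 10000) (19 / 4) (21 / 4) (1 / 200) (1 / 200) (1 / 20) 1 2 (1 / 16) (1 / 50)) :
    CoolMoatSlavedFillingP ϑc (1 / 100) (1 / 10) 8 4 12 16 16 (1 / 2) 1 2 (1 / 16) (1 / 50) :=
  have hSV := singleVariantP₂_of_coherentBondLabel₂ hCBL
  coolMoatSlavedFillingP_tubeSlot_of_enclosure hlam hSC (enclosureNetP_instance_of_variantLabel₂ hSV hAR hLN)
    (coreOccupancyP_instance_of_variantLabel₂ hSV hAR hLN hCV) hX1 hX2

end W1PiecesBis

end Summit.AtomisticToContinuum.Crystallization.Theorems.ChartedZeroExcessLayeredLatticeLiouville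

end
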